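/-
Copyright (c) 2026. Released under Apache 2.0 license.
-/
import Summits.RiemannHypothesis.RiemannHypothesis.Theorems.MotivicDoorSemilocalUndecicPolar
import Summits.RiemannHypothesis.RiemannHypothesis.Theorems.MotivicDoorSemilocalUndecicKernelA
import Summits.RiemannHypothesis.RiemannHypothesis.Theorems.MotivicDoorSemilocalQuinticCells
import HarnessLib

/-!
# Motivic door, semi-local ladder — cell, origin-cell and tail estimates for the degree-11 certificate

Pub speedrun, cell `pub-rhdoor`, seat `lad-2`, generation 5 (rung R3⁻(0.57)); the analytic half
of the certificate, joining the witness files (`…UndecicWitness`, `…UndecicPolar`) to the kernel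
numerics (`…UndecicKernelA/B`).  Verbatim the generation-4 scheme (`…QuinticCells.lean`) for the
new data: grid `a_i = i/2000` (`ag`), `τ_i = a_i/b = i/1140`, `b = 0.57`.

* `cellU_le`: on `[a_i, a_{i+1}]`, `i ≥ 1`: `∫ w D(G) ≤ 2b² · gcellR iU 1140 i` (`w` antitone,
  `D ≥ 0`, `∫ Δ` exact via the antiderivative list `iU`);
* `cellU_zero_le`: `∫₀^{a_1} w D(G) ≤ 211.21` (`t w(t) ≤ 1/2 + t`);
* `tailU_le`: `∫_{2b}^∞ w D(G) ≤ 2N · T(e^{-b})` (three-term geometric majorant of `w`).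

PROVED here: everything stated.
-/

set_option linter.dupNamespace false

noncomputable section

open MeasureTheory Set Filter Topology Real Finset
open Literature.NumberTheory.LFunctions
open Literature.Analysis.ValidatedNumerics.Numerics

namespace Summit.RiemannHypothesis.RiemannHypothesis.Theorems.MotivicDoor.SemilocalUndecic

open SemilocalMarkov SemilocalKernel SemilocalUndecicKernel SemilocalQuintic GroundStateSimpleEven

/-! ## The antiderivative -/

/-- `∫ᵤᵛ Δ = IΔ(v) - IΔ(u)` with `IΔ = hornerR iU`. -/
theorem integral_polyR_dU (u v : ℝ) :
    ∫ τ in u..v, SemilocalQuintic.polyR dU τ = hornerR iU v - hornerR iU u := by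
  rw [integral_polyR]
  simp only [dU, qU, iU, hornerR, List.length_cons, List.length_nil, Finset.sum_range_succ,
    Finset.sum_range_zero, List.getD_cons_succ, List.getD_cons_zero]
  push_cast
  ring

/-! ## The cells `i ≥ 1` -/

/-- `a_{2280} = 2b`. -/
theorem ag_lastU : ag 2280 = 2 * bU := by unfold ag bU; norm_num

/-- On the cell `[a_i, a_{i+1}]`, `1 ≤ i ≤ 2279`:  `∫ w D ≤ 2 b² gcellR iU 1140 i`. -/
theorem cellU_le {i : ℕ} (hi : 1 ≤ i) (hi' : i + 1 ≤ 2280) :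
    ∫ t in ag i..ag (i + 1), weilArchDensity t * weilIncrement GU t
      ≤ 2 * bU ^ 2 * gcellR iU 1140 i := by
  have hb := bU_pos
  have hi1 : (1 : ℝ) ≤ i := by exact_mod_cast hi
  have hi2 : ((i : ℝ) + 1) ≤ 2280 := by exact_mod_cast hi'
  have hai : 0 < ag i := by unfold ag; positivity
  have hle : ag i ≤ ag (i + 1) := by unfold ag; push_cast; linarith
  have htop : ag (i + 1) ≤ 2 * bU := by unfold ag bU; push_cast; linarith
  have hf : IntervalIntegrable (fun t ↦ weilArchDensity t * weilIncrement GU t) volume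
      (ag i) (ag (i + 1)) :=
    (intervalIntegrable_iff_integrableOn_Ioc_of_le hle).2
      (integrableOn_w_mul_weilIncrement_GU.mono_set fun t ht ↦ lt_trans hai ht.1)
  have hgc : Continuous fun t ↦ weilArchDensity (ag i) * (2 * bU * SemilocalQuintic.polyR dU (t / bU)) :=
    continuous_const.mul (continuous_const.mul
      ((continuous_polyR _).comp (continuous_id.div_const _)))
  have hmono := intervalIntegral.integral_mono_on hle hf (hgc.intervalIntegrable _ _)
    (fun t ht ↦ by
      have ht0 : 0 < t := lt_of_lt_of_le hai ht.1
      have ht2 : t ≤ 2 * bU := ht.2.trans htop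
      rw [weilIncrement_GU_eq ht0.le ht2]
      have hw : weilArchDensity t ≤ weilArchDensity (ag i) :=
        weilArchDensity_antitoneOn hai (mem_Ioi.2 ht0) ht.1
      have hΔ : 0 ≤ 2 * bU * SemilocalQuintic.polyR dU (t / bU) :=
        mul_nonneg (by positivity) (polyR_dU_nonneg (by positivity)
          (by rw [div_le_iff₀ hb]; linarith))
      exact mul_le_mul_of_nonneg_right hw hΔ)
  refine hmono.trans (le_of_eq ?_)
  rw [intervalIntegral.integral_const_mul, intervalIntegral.integral_const_mul,
    intervalIntegral.integral_comp_div (fun τ ↦ SemilocalQuintic.polyR dU τ) hb.ne',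
    integral_polyR_dU, smul_eq_mul, tuf_weilArchDensity_eq_z hai, gcellR, wR]
  have e1 : ag i / bU = (i : ℝ) / (1140 : ℕ) := by unfold ag bU; push_cast; field_simp; ring
  have e2 : ag (i + 1) / bU = ((i : ℝ) + 1) / (1140 : ℕ) := by
    unfold ag bU; push_cast; field_simp; ring
  rw [e1, e2]
  unfold ag
  ring

/-! ## The cell at the origin -/

/-- Coefficients of `(1 + 2bτ) q(τ)`. -/
def e0U : List ℚ := [409600, 29237248, -6444843008/75, 2240782336/5, -41951137792/25,
  349269469184/125, -218783415296/175, -419125207296/175, 60892600448/15, -64945764736/25,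
  209562534592/275, -27331456224/275, 10993056, 313302096/25, -24091944/5, -686620404/125,
  2310069/2, 131673933/100, -12520651/76, -37561953/200, 26741/2, 1524237/100, -88179/184,
  -5026203/9200]

/-- `(1 + 2bτ) q(τ) = polyR e0U τ`. -/
theorem e0U_identity (τ : ℝ) :
    (1 + 2 * bU * τ) * SemilocalQuintic.polyR qU τ = SemilocalQuintic.polyR e0U τ := by
  simp only [SemilocalQuintic.polyR, qU, e0U, bU]; push_cast; ring

/-- `q ≥ 0` on `(0, 2]`. -/
theorem polyR_qU_nonneg {τ : ℝ} (h0 : 0 < τ) (h2 : τ ≤ 2) : 0 ≤ SemilocalQuintic.polyR qU τ := by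
  have h := polyR_dU_nonneg h0.le h2
  rw [polyR_dU] at h
  exact (mul_nonneg_iff_of_pos_left h0).1 h

/-- `q(0) = 409600`. -/
theorem polyR_qU_zero : SemilocalQuintic.polyR qU 0 = 409600 := by
  simp [SemilocalQuintic.polyR, qU]

/-- The cell at the origin: `∫₀^{a_1} w D ≤ 211.21`. -/
theorem cellU_zero_le :
    ∫ t in ag 0..ag 1, weilArchDensity t * weilIncrement GU t ≤ 21121 / 100 := by
  have hb := bU_pos
  rw [ag_zero]
  have ha1 : ag 1 = 1 / 2000 := by unfold ag; norm_num
  have hle : (0 : ℝ) ≤ ag 1 := by rw [ha1]; norm_num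
  have hf : IntervalIntegrable (fun t ↦ weilArchDensity t * weilIncrement GU t) volume 0 (ag 1) :=
    (intervalIntegrable_iff_integrableOn_Ioc_of_le hle).2
      (integrableOn_w_mul_weilIncrement_GU.mono_set fun t ht ↦ ht.1)
  set g0 : ℝ → ℝ := fun τ ↦ (1 + 2 * bU * τ) * SemilocalQuintic.polyR qU τ with hg0
  have hgc : Continuous fun t ↦ g0 (t / bU) := by
    rw [hg0]
    exact ((continuous_const.add (continuous_const.mul continuous_id)).mul
      (continuous_polyR _)).comp (continuous_id.div_const _)
  have hmono := intervalIntegral.integral_mono_on hle hf (hgc.intervalIntegrable _ _)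
    (fun t ht ↦ by
      have ht2 : t ≤ 2 * bU := by rw [ha1] at ht; unfold bU; linarith [ht.2]
      rw [weilIncrement_GU_eq ht.1 ht2, polyR_dU]
      rcases ht.1.eq_or_lt with h0 | h0
      · subst h0
        simp only [zero_div, zero_mul, mul_zero, hg0, polyR_qU_zero]; norm_num
      · have hτ2 : t / bU ≤ 2 := by rw [div_le_iff₀ hb]; linarith
        have hq := polyR_qU_nonneg (div_pos h0 hb) hτ2
        have hw := mul_weilArchDensity_le h0
        simp only [hg0]
        have : weilArchDensity t * (2 * bU * (t / bU * SemilocalQuintic.polyR qU (t / bU)))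
            = 2 * (t * weilArchDensity t) * SemilocalQuintic.polyR qU (t / bU) := by
          field_simp
        rw [this, show (1 + 2 * bU * (t / bU)) = 2 * (1 / 2 + t) by field_simp]
        exact mul_le_mul_of_nonneg_right (by linarith) hq)
  refine hmono.trans ?_
  rw [intervalIntegral.integral_comp_div g0 hb.ne', zero_div, hg0]
  simp_rw [e0U_identity]
  rw [integral_polyR, smul_eq_mul, ha1]
  simp only [e0U, List.length_cons, List.length_nil, Finset.sum_range_succ, Finset.sum_range_zero,
    List.getD_cons_succ, List.getD_cons_zero, bU]
  norm_num

/-! ## The tail `t ≥ 2b` -/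

/-- The tail: `∫_{2b}^∞ w D ≤ 2N · T(e^{-b})`. -/
theorem tailU_le :
    ∫ t in Ioi (2 * bU), weilArchDensity t * weilIncrement GU t
      ≤ 2 * NU * tailT (Real.exp (-bU)) := by
  have hb := bU_pos
  have hN : 0 ≤ 2 * NU := by unfold NU n2U bU; norm_num
  set e := Real.exp (-bU) with he
  have he4 : e ^ 4 = Real.exp (-(2 * (2 * bU))) := by rw [he, ← Real.exp_nat_mul]; ring_nf
  have he4' : e ^ 4 < 1 := by rw [he4]; exact Real.exp_lt_one_iff.2 (by linarith)
  -- the majorant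
  set m : ℝ → ℝ := fun t ↦ 2 * NU * (Real.exp (-(1 / 2) * t) + Real.exp (-(5 / 2) * t)
      + Real.exp (-(9 / 2) * t) / (1 - e ^ 4)) with hm
  have hmi : IntegrableOn m (Ioi (2 * bU)) := by
    rw [hm]
    refine Integrable.const_mul ((Integrable.add ?_ ?_).add ?_) _
    · exact exp_neg_integrableOn_Ioi _ (by norm_num)
    · exact exp_neg_integrableOn_Ioi _ (by norm_num)
    · exact (exp_neg_integrableOn_Ioi _ (by norm_num)).div_const _
  have hfi : IntegrableOn (fun t ↦ weilArchDensity t * weilIncrement GU t) (Ioi (2 * bU)) :=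
    integrableOn_w_mul_weilIncrement_GU.mono_set (Ioi_subset_Ioi (by linarith))
  have hmono : ∫ t in Ioi (2 * bU), weilArchDensity t * weilIncrement GU t
      ≤ ∫ t in Ioi (2 * bU), m t := by
    refine setIntegral_mono_on hfi hmi measurableSet_Ioi fun t (ht : 2 * bU < t) ↦ ?_
    have ht0 : 0 < t := by linarith
    rw [weilIncrement_GU_eq_of_lt ht, hm]
    simp only
    rw [mul_comm (weilArchDensity t)]
    refine mul_le_mul_of_nonneg_left ?_ hN
    have h := weilArchDensity_le_tail (by linarith : 0 < 2 * bU) ht.le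
    rw [← he4] at h
    have a1 : Real.exp (-(1 / 2) * t) = Real.exp (-(t / 2)) := by congr 1; ring
    have a5 : Real.exp (-(5 / 2) * t) = Real.exp (-(5 * t / 2)) := by congr 1; ring
    have a9 : Real.exp (-(9 / 2) * t) = Real.exp (-(9 * t / 2)) := by congr 1; ring
    rw [a1, a5, a9]
    exact h
  refine hmono.trans (le_of_eq ?_)
  rw [hm, integral_const_mul]
  congr 1
  rw [integral_add, integral_add, integral_div, integral_exp_mul_Ioi (by norm_num),
    integral_exp_mul_Ioi (by norm_num), integral_exp_mul_Ioi (by norm_num)]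
  · simp only [tailT]
    have e5 : Real.exp (-(5 / 2) * (2 * bU)) = e * e ^ 4 := by
      rw [he, ← pow_succ', ← Real.exp_nat_mul]; ring_nf
    have e9 : Real.exp (-(9 / 2) * (2 * bU)) = e * (e ^ 4) ^ 2 := by
      rw [he, ← pow_mul, ← pow_succ', ← Real.exp_nat_mul]; ring_nf
    have e1 : Real.exp (-(1 / 2) * (2 * bU)) = e := by rw [he]; ring_nf
    rw [e1, e5, e9]
    ring
  · exact exp_neg_integrableOn_Ioi _ (by norm_num)
  · exact exp_neg_integrableOn_Ioi _ (by norm_num)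
  · exact (exp_neg_integrableOn_Ioi _ (by norm_num)).add (exp_neg_integrableOn_Ioi _ (by norm_num))
  · exact (exp_neg_integrableOn_Ioi _ (by norm_num)).div_const _

end Summit.RiemannHypothesis.RiemannHypothesis.Theorems.MotivicDoor.SemilocalUndecic

end
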